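import Literature.Probability.Percolation.ArmExponentsTwoArm
import Literature.Probability.Percolation.ArmEventsStructure
import Literature.Probability.Percolation.TriAnnulusCrossingProofs
import Literature.Probability.Percolation.TriRSWChaining
import HarnessLib

/-!
# A-priori power-law bounds for the one- and two-arm probabilities on `𝕋` at `p = 1/2`

Topic: Probability / Percolation; family `crit-perc` (critical site percolation `P_{1/2}` on the
triangular lattice `𝕋 = triGraph`, hexagonal annuli `Λ_N \ Λ_n`, `Λ_n = triBall n`,
`|·|_𝕋 = triNorm`). Everything in this file is PROVED. It records, for `j = 1` and for the
polychromatic case `j = 2` (`σ = BW`, `armEvent ![true, false]`, probability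
`b(n, N) = critTwoArmProb n N`), the **a-priori bounds** of Nolin 2008, Prop. 14
[arXiv 0711.4948: Prop. 13] ("there exist exponents `0 < α_j, α' < ∞` and constants
`0 < C_j, C' < ∞` such that `C_j (n/N)^{α_j} ≤ P̂(Ã_{j,σ}(n, N)) ≤ C' (n/N)^{α'}`"; the lower
bound "comes from iterating" RSW extensions, "the upper bound can be obtained by using
concentric annuli"), in the plain (non-separated) form `A_{j,σ} ⊇ Ã_{j,σ}`, which is also the
input "by standard RSW theory, `b_j(r, R)` is bounded from below by a power of `R/r`" of
Smirnov–Werner 2001, §4.2 (before (15)):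

* `Literature.Probability.Percolation.exists_polyArmProb_one_le_rpow` — **upper bound, one arm**: there are `C, α > 0`
  with `P_{1/2}(armEvent ![c] n N) ≤ C (n/N)^α` for all `1 ≤ n ≤ N` and both colours `c`; from
  the tree's PROVED annulus lemma of Bollobás–Riordan (Ch. 7, Lemma 4:
  `tri_annulusCrossing_bound_holds`, `TriAnnulusCrossingProofs.lean`) and the sandwich
  `{‖·‖ ≤ (√3/2) N} ⊆ Λ_N ⊆ {‖·‖ ≤ N}` (`OneArmLSW.lean`): an arm across `Λ_N \ Λ_n` crosses the
  Euclidean annulus `A(n + 1, 0.86 N)` (`armEvent_one_subset_triAnnulusCrossing`).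
* `Literature.Probability.Percolation.exists_critTwoArmProb_le_rpow` — **upper bound, two arms** (Nolin Prop. 14, upper
  half, `j = 2`): `b(n, N) ≤ C (n/N)^α`, by the Harris bound `b ≤ P_{1/2}(one arm)²`
  (`polyArmProb_two_le_sq`, `ArmEventsStructure.lean`; Nolin §4.1, Remark).
* `Literature.Probability.Percolation.exists_rpow_le_critTwoArmProb` — **lower bound, two arms** (Nolin Prop. 14, lower
  half, `j = 2`; Smirnov–Werner §4.2): `c (n/N)^ζ ≤ b(n, N)` for all `1 ≤ n ≤ N`. The RSW
  construction (`armEvent_one_of_dyadicChain`, `exists_pow_le_real_dyadicChain`): open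
  horizontal crossings of the parallelograms `[2^i n, 2^{i+2} n] × [-2^i n, 0]` (`i ≤ k`) and
  open vertical crossings of the rhombi `[2^{i+1} n, 2^{i+2} n] × [-2^{i+1} n, 0]` (`i < k`),
  all lying in the cone `{-x₀ ≤ x₁ ≤ 0}` over the right sides of the hexagons (where
  `|·|_𝕋 = x₀`), glue (consecutive horizontal crossings both cross the rhombus between them,
  where they meet its vertical crossing: `exists_mem_of_cross`, from the tree's
  `PathIn.exists_slab_crossing` and `PathIn.tri_crossings_meet`) into an open arm across
  `Λ_{2^{k+2} n} \ Λ_n`; by the RSW box-crossing property `tri_rsw_half_holds` and the Harris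
  chain (`sitePercolation_real_biInter_ge_prod`) this has probability `≥ c₀^{2k+1}`; the image
  of this event under the central symmetry composed with colour exchange (which preserves
  `P_{1/2}`: `sitePercolation_real_preimage_relabel`, `sitePercolation_real_preimage_compl`)
  is a closed arm on the left, independent of it (disjoint sites); `armEvent_two_eq_inter`
  and the anti-monotonicity of `b(n, ·)` (`polyArmProb_anti_holds`) finish, with
  `k = ⌊log₂ (N/n)⌋` and `ζ = 4 log₂ (1/c₀)`.
* `Literature.Probability.Percolation.exists_rpow_le_polyArmProb_one` — the same lower bound for one arm.

Toolbox (namespace `Literature.StatMech`): `triNorm` arithmetic (`triNorm_lt_iff_lin`,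
`triNorm_le_iff_lin`, `le_triNorm_iff_lin`, `lt_triNorm_iff_lin`, `triNorm_neg`,
`triNorm_eq_apply_zero`), one-colour arm events as `PathIn` of coloured sites
(`mem_armEvent_one_iff_exists_pathIn`), the central symmetry with colour exchange on one-arm
events (`mem_armEvent_one_of_relabel_neg_compl`), `coe_image_neg`, and the box-meeting lemma
`exists_mem_of_cross`.

## References

* P. Nolin, *Near-critical percolation in two dimensions*, EJP 13 (2008), §4.1 (Remark) and
  Prop. 14 [arXiv 0711.4948: Prop. 13]. [Nolin2008]
* S. Smirnov, W. Werner, *Critical exponents for two-dimensional percolation*, MRL 8 (2001),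
  §4.2. [SmirnovWernerMRL2001]
* B. Bollobás, O. Riordan, *Percolation*, CUP (2006), Ch. 7, Lemma 4. [BollobasRiordan2006]
* H. Kesten, *Percolation theory for mathematicians* (1982), §2.2 (crossing paths meet).
  [KestenPTM1982]
* G. Grimmett, *Percolation*, 2nd ed. (1999), §11.7 (RSW chaining). [GrimmettPercolation1999]

Mathlib: `Real.rpow`, `Real.log`, `Nat.log`, `SimpleGraph.Walk.toPath`; no percolation in
Mathlib. Tree: `ArmEventsProofs` (`armEvent_mono_left`, `polyArmProb_anti_holds`,
`triNorm_eq_max`), `ArmEventsStructure` (`armEvent_two_eq_inter`, `polyArmProb_two_le_sq`),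
`TriRSWChaining` (`triHCross`, `triVCross`, `triNegIso`, `PathIn.exists_support`),
`TriPathCrossings`, `TriCrossingsMeet`, `SiteHarrisChain`, `TriThetaHalf` (`tri_rsw_half_holds`),
`TriAnnulusCrossingProofs` (`tri_annulusCrossing_bound_holds`), `OneArmLSW`
(`norm_triEmbed_le_triNorm`, `mul_triNorm_le_norm_triEmbed`).
-/

noncomputable section

open MeasureTheory Set SimpleGraph

namespace Literature.Probability.Percolation

/-! ### `triNorm` arithmetic -/

/-- `triNorm x < ρ` unfolded into six linear inequalities. [folklore] -/
theorem triNorm_lt_iff_lin {x : LatticeModels.Site 2} {ρ : ℤ} :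
    LatticeModels.triNorm x < ρ ↔ x 0 < ρ ∧ -x 0 < ρ ∧ x 1 < ρ ∧ -x 1 < ρ ∧ x 0 + x 1 < ρ ∧ -(x 0 + x 1) < ρ := by
  rw [triNorm_eq_max]; simp only [max_lt_iff]; tauto

/-- `triNorm x ≤ ρ` unfolded into six linear inequalities. [folklore] -/
theorem triNorm_le_iff_lin {x : LatticeModels.Site 2} {ρ : ℤ} :
    LatticeModels.triNorm x ≤ ρ ↔ x 0 ≤ ρ ∧ -x 0 ≤ ρ ∧ x 1 ≤ ρ ∧ -x 1 ≤ ρ ∧ x 0 + x 1 ≤ ρ ∧ -(x 0 + x 1) ≤ ρ := by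
  rw [triNorm_eq_max]; simp only [max_le_iff]; tauto

/-- `ρ ≤ triNorm x` unfolded. [folklore] -/
theorem le_triNorm_iff_lin {x : LatticeModels.Site 2} {ρ : ℤ} :
    ρ ≤ LatticeModels.triNorm x ↔ ρ ≤ x 0 ∨ ρ ≤ -x 0 ∨ ρ ≤ x 1 ∨ ρ ≤ -x 1 ∨ ρ ≤ x 0 + x 1 ∨ ρ ≤ -(x 0 + x 1) := by
  rw [triNorm_eq_max]; simp only [le_max_iff]; tauto

/-- `ρ < triNorm x` unfolded. [folklore] -/
theorem lt_triNorm_iff_lin {x : LatticeModels.Site 2} {ρ : ℤ} :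
    ρ < LatticeModels.triNorm x ↔ ρ < x 0 ∨ ρ < -x 0 ∨ ρ < x 1 ∨ ρ < -x 1 ∨ ρ < x 0 + x 1 ∨ ρ < -(x 0 + x 1) := by
  rw [triNorm_eq_max]; simp only [lt_max_iff]; tauto

/-- `triNorm` is invariant under the central symmetry. [folklore] -/
theorem triNorm_neg (x : LatticeModels.Site 2) : LatticeModels.triNorm (-x) = LatticeModels.triNorm x := by
  apply le_antisymm
  · rw [triNorm_le_iff_lin]
    have h2 := triNorm_le_iff_lin (x := x) (ρ := LatticeModels.triNorm x) |>.1 le_rfl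
    simp only [Pi.neg_apply]; omega
  · rw [triNorm_le_iff_lin]
    have h2 := triNorm_le_iff_lin (x := -x) (ρ := LatticeModels.triNorm (-x)) |>.1 le_rfl
    simp only [Pi.neg_apply] at h2; omega

/-- In the cone over the right side of the hexagon (`-x₀ ≤ x₁ ≤ 0`) the graph norm is `x₀`. [folklore] -/
theorem triNorm_eq_apply_zero {x : LatticeModels.Site 2} (h1 : x 1 ≤ 0) (h2 : 0 ≤ x 0 + x 1) : LatticeModels.triNorm x = x 0 := by
  apply le_antisymm
  · rw [triNorm_le_iff_lin]; omega
  · exact le_triNorm_iff_lin.2 (Or.inl le_rfl)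

/-- The image of a finite set of sites under `x ↦ -x`, as a set, is its preimage. [folklore] -/
theorem coe_image_neg (F : Finset (LatticeModels.Site 2)) :
    (↑(F.image Neg.neg) : Set (LatticeModels.Site 2)) = Neg.neg ⁻¹' ↑F := by
  ext v
  simp only [Finset.coe_image, Set.mem_image, Finset.mem_coe, Set.mem_preimage]
  constructor
  · rintro ⟨w, hw, rfl⟩; simpa using hw
  · intro h; exact ⟨-v, h, neg_neg v⟩

/-! ### One-colour arm events as paths of coloured sites -/

/-- **Arms as `PathIn`.** For `r ≤ R`, `ω ∈ armEvent ![c] r R` iff some site of `∂Λ_r` is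
joined to some site of `∂Λ_R` by a `𝕋`-path of sites of colour `c` inside the closed annulus
`{r ≤ |·|_𝕋 ≤ R}` (a walk of coloured sites contains a self-avoiding one, `Walk.toPath`). [cite: SmirnovWernerMRL2001, §3] -/
theorem mem_armEvent_one_iff_exists_pathIn {c : Bool} {r R : ℕ} (hrR : r ≤ R)
    {ω : SiteConfig (LatticeModels.Site 2)} :
    ω ∈ armEvent ![c] r R ↔ ∃ x ∈ LatticeModels.triSphere r, ∃ y ∈ LatticeModels.triSphere R,
      PathIn LatticeModels.triGraph ({v : LatticeModels.Site 2 | (r : ℤ) ≤ LatticeModels.triNorm v ∧ LatticeModels.triNorm v ≤ R} ∩ {v | v ∈ ω ↔ c})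
        x y := by
  classical
  constructor
  · rintro ⟨x, y, w, hw, -⟩
    obtain ⟨hx, hy, -, hsupp, hcol⟩ := hw 0
    refine ⟨x 0, hx, y 0, hy, PathIn.of_walk (w 0) fun v hv => ⟨?_, ?_⟩⟩
    · exact mem_triAnnulus.1 (mem_triAnnulus_of_arm hrR (hsupp v hv))
    · simpa using hcol v hv
  · rintro ⟨x, hx, y, hy, hp⟩
    obtain ⟨W, hW⟩ := hp.exists_walk
    refine ⟨fun _ => x, fun _ => y, fun _ => (W.toPath : LatticeModels.triGraph.Walk x y), fun j => ?_,
      Subsingleton.pairwise⟩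
    have hsub : ∀ v ∈ (W.toPath : LatticeModels.triGraph.Walk x y).support,
        v ∈ {v : LatticeModels.Site 2 | (r : ℤ) ≤ LatticeModels.triNorm v ∧ LatticeModels.triNorm v ≤ R} ∩ {v | v ∈ ω ↔ c} :=
      fun v hv => hW v (SimpleGraph.Walk.support_toPath_subset_support W hv)
    refine ⟨hx, hy, W.toPath.2, fun v hv => ?_, fun v hv => ?_⟩
    · have h := (hsub v hv).1
      simp only [Set.mem_setOf_eq] at h
      rcases eq_or_lt_of_le h.1 with h1 | h1
      · right; rw [LatticeModels.mem_triSphere_iff, ← h1]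
      · left
        simp only [Set.mem_sdiff, Finset.mem_coe, LatticeModels.mem_triBall_iff, not_le]
        exact ⟨h.2, h1⟩
    · have h := (hsub v hv).2
      simpa using h

/-- The spheres `∂Λ_n` are symmetric under `x ↦ -x`. [folklore] -/
theorem neg_mem_triSphere_iff {n : ℕ} {v : LatticeModels.Site 2} : -v ∈ LatticeModels.triSphere n ↔ v ∈ LatticeModels.triSphere n := by
  simp [triNorm_neg]

/-- **Central symmetry composed with colour exchange turns arms of colour `c` into arms of
colour `!c`**: if the configuration `{x | -x ∈ ω}ᶜ` has an arm of colour `c` across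
`Λ_R \ Λ_r`, then `ω` has an arm of colour `!c` (Smirnov–Werner 2001, Rem. 2: colour exchange;
lattice symmetry). [cite: SmirnovWernerMRL2001, Rem. 2] -/
theorem mem_armEvent_one_of_relabel_neg_compl {c : Bool} {r R : ℕ} (hrR : r ≤ R)
    {ω : SiteConfig (LatticeModels.Site 2)}
    (h : (SiteConfig.relabel (Equiv.neg (LatticeModels.Site 2)) ω)ᶜ ∈ armEvent ![c] r R) :
    ω ∈ armEvent ![!c] r R := by
  rw [mem_armEvent_one_iff_exists_pathIn hrR] at h ⊢
  obtain ⟨x, hx, y, hy, hp⟩ := h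
  refine ⟨-x, neg_mem_triSphere_iff.2 hx, -y, neg_mem_triSphere_iff.2 hy, ?_⟩
  have hp' := pathIn_map_iso triNegIso hp
  simp only [triNegIso_apply] at hp'
  refine hp'.mono ?_
  rintro v ⟨w, ⟨hw1, hw2⟩, rfl⟩
  refine ⟨?_, ?_⟩
  · simp only [Set.mem_setOf_eq, triNorm_neg] at hw1 ⊢
    exact hw1
  · simp only [Set.mem_setOf_eq, Set.mem_compl_iff, SiteConfig.mem_relabel_iff,
      Equiv.neg_symm, Equiv.neg_apply] at hw2 ⊢
    cases c <;> simp_all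

/-! ### Upper bounds: an arm crosses a Euclidean annulus -/

/-- `0.86 < √3 / 2`. [folklore] -/
theorem const_lt_sqrt_three_div_two : (86 / 100 : ℝ) < Real.sqrt 3 / 2 := by
  rw [lt_div_iff₀ (by norm_num : (0 : ℝ) < 2)]
  exact (Real.lt_sqrt (by norm_num)).2 (by norm_num)

/-- **An arm crosses a Euclidean annulus.** An arm of colour `c` across `Λ_N \ Λ_n` starts inside
the open disc of radius `n + 1` (`Λ_n ⊆ {‖·‖ ≤ n}`) and ends outside the closed disc of radius
`0.86 N` (`∂Λ_N` lies outside the open disc of radius `(√3/2) N`), so it is a monochromatic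
crossing of the Euclidean annulus `A(n + 1, 0.86 N)` of the unit-mesh lattice
(`triAnnulusCrossing c 1 0`). [cite: BollobasRiordan2006, Ch. 7 Lemma 4 (p. 166)] -/
theorem armEvent_one_subset_triAnnulusCrossing (c : Bool) {n N : ℕ} (hN : 1 ≤ N) :
    armEvent ![c] n N ⊆
      Literature.Probability.Percolation.triAnnulusCrossing c 1 0 ((n : ℝ) + 1) (86 / 100 * (N : ℝ)) := by
  rintro ω ⟨x, y, w, hw, -⟩
  obtain ⟨hx, hy, -, -, hcol⟩ := hw 0
  refine ⟨x 0, y 0, w 0, ?_, ?_, fun v hv => hcol v hv⟩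
  · have h1 : ‖LatticeModels.triEmbed (x 0)‖ ≤ (LatticeModels.triNorm (x 0) : ℝ) := Literature.Probability.Percolation.norm_triEmbed_le_triNorm (x 0)
    have h2 : (LatticeModels.triNorm (x 0) : ℝ) = n := by
      rw [LatticeModels.mem_triSphere_iff] at hx; exact_mod_cast hx
    simp only [LatticeModels.triMeshPoint, Complex.ofReal_one, one_mul, sub_zero]
    linarith
  · have h1 := Literature.Probability.Percolation.mul_triNorm_le_norm_triEmbed (y 0)
    have h2 : (LatticeModels.triNorm (y 0) : ℝ) = N := by
      rw [LatticeModels.mem_triSphere_iff] at hy; exact_mod_cast hy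
    rw [h2] at h1
    simp only [LatticeModels.triMeshPoint, Complex.ofReal_one, one_mul, sub_zero]
    have hN' : (1 : ℝ) ≤ N := by exact_mod_cast hN
    have := const_lt_sqrt_three_div_two
    nlinarith

end Literature.Probability.Percolation

namespace Literature.Probability.Percolation

open LatticeModels

/-- **A-priori upper bound for one arm** (Nolin 2008, Prop. 14 [arXiv 0711.4948: Prop. 13],
upper half, `j = 1`, `p = 1/2`: "the upper bound can be obtained by using concentric annuli:
in each of them, RSW implies that there is a probability bounded away from zero to observe a
black circuit, preventing the existence of a white arm"; here from Bollobás–Riordan's annulus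
lemma, Ch. 7, Lemma 4, PROVED in the tree as `tri_annulusCrossing_bound_holds`). There are
`C, α > 0` with `P_{1/2}(armEvent ![c] n N) ≤ C (n/N)^α` for all `1 ≤ n ≤ N` and both
colours `c`. [cite: Nolin2008, Prop. 14 (arXiv 0711.4948: Prop. 13)] -/
theorem exists_polyArmProb_one_le_rpow :
    ∃ C α : ℝ, 0 < C ∧ 0 < α ∧ ∀ (c : Bool) (n N : ℕ), 1 ≤ n → n ≤ N →
      polyArmProb ![c] n N ≤ C * ((n : ℝ) / N) ^ α := by
  obtain ⟨α, hα, hb⟩ := tri_annulusCrossing_bound_holds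
  refine ⟨(3000 : ℝ) ^ α, α, by positivity, hα, fun c n N hn hnN => ?_⟩
  have hle1 : polyArmProb ![c] n N ≤ 1 := measureReal_le_one
  have hn' : (1 : ℝ) ≤ n := by exact_mod_cast hn
  have hN' : (n : ℝ) ≤ N := by exact_mod_cast hnN
  have hNpos : (0 : ℝ) < N := by linarith
  have hratio_pos : 0 < (n : ℝ) / N := by positivity
  have hratio_le : (n : ℝ) / N ≤ 1 := by rw [div_le_one hNpos]; exact hN'
  -- the main case: `999 ≤ m ≤ N / 3 - 1`, for an intermediate radius `m`
  have main : ∀ m : ℕ, 999 ≤ m → 3 * m + 3 ≤ N → n ≤ m →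
      polyArmProb ![c] n N ≤ (3 : ℝ) ^ α * ((m : ℝ) / N) ^ α := by
    intro m hm hmN hnm
    have hmN' : m ≤ N := by omega
    have h1 : polyArmProb ![c] n N ≤ polyArmProb ![c] m N :=
      measureReal_mono (armEvent_mono_left _ hnm hmN') (measure_ne_top _ _)
    have h2 : polyArmProb ![c] m N ≤
        (triSitePercolation half).real (triAnnulusCrossing c 1 0 ((m : ℝ) + 1) (86 / 100 * N)) :=
      measureReal_mono (armEvent_one_subset_triAnnulusCrossing c (by omega)) (measure_ne_top _ _)
    have hm' : (999 : ℝ) ≤ m := by exact_mod_cast hm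
    have hmN'' : (3 : ℝ) * m + 3 ≤ N := by exact_mod_cast hmN
    have h3 := hb c 1 0 ((m : ℝ) + 1) (86 / 100 * N) one_pos (by linarith) (by nlinarith)
    refine h1.trans (h2.trans (h3.trans ?_))
    have hq : ((m : ℝ) + 1) / (86 / 100 * N) ≤ 3 * ((m : ℝ) / N) := by
      rw [div_le_iff₀ (by positivity)]
      have : 3 * ((m : ℝ) / N) * (86 / 100 * N) = (258 / 100) * m := by
        field_simp
        ring
      rw [this]; linarith
    calc (((m : ℝ) + 1) / (86 / 100 * N)) ^ α ≤ (3 * ((m : ℝ) / N)) ^ α :=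
          Real.rpow_le_rpow (by positivity) hq hα.le
      _ = (3 : ℝ) ^ α * ((m : ℝ) / N) ^ α := Real.mul_rpow (by norm_num) (by positivity)
  -- trivial bound `1 ≤ 3000^α (n/N)^α` when `N < 3000 n`
  have small : (N : ℝ) < 3000 * n → polyArmProb ![c] n N ≤ (3000 : ℝ) ^ α * ((n : ℝ) / N) ^ α := by
    intro hlt
    refine hle1.trans ?_
    have h1 : (1 : ℝ) ≤ 3000 * ((n : ℝ) / N) := by
      rw [mul_div_assoc', le_div_iff₀ hNpos]; linarith
    calc (1 : ℝ) = 1 ^ α := (Real.one_rpow α).symm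
      _ ≤ (3000 * ((n : ℝ) / N)) ^ α := Real.rpow_le_rpow zero_le_one h1 hα.le
      _ = (3000 : ℝ) ^ α * ((n : ℝ) / N) ^ α := Real.mul_rpow (by norm_num) (by positivity)
  by_cases hN3 : (N : ℝ) < 3000 * n
  · exact small hN3
  rw [not_lt] at hN3
  have hN3' : 3000 * n ≤ N := by exact_mod_cast hN3
  by_cases hn9 : 999 ≤ n
  · -- `m = n`
    have h := main n hn9 (by omega) le_rfl
    refine h.trans ?_
    gcongr
    · norm_num
  · -- `m = 999`
    rw [not_le] at hn9
    have h := main 999 le_rfl (by omega) hn9.le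
    refine h.trans ?_
    have hq : ((999 : ℕ) : ℝ) / N ≤ 999 * ((n : ℝ) / N) := by
      rw [mul_div_assoc', div_le_div_iff_of_pos_right hNpos]
      push_cast; linarith
    calc (3 : ℝ) ^ α * (((999 : ℕ) : ℝ) / N) ^ α ≤ (3 : ℝ) ^ α * (999 * ((n : ℝ) / N)) ^ α := by
          gcongr
      _ = ((3 : ℝ) ^ α * (999 : ℝ) ^ α) * ((n : ℝ) / N) ^ α := by
          rw [Real.mul_rpow (by norm_num) (by positivity)]; ring
      _ = ((3 * 999 : ℝ)) ^ α * ((n : ℝ) / N) ^ α := by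
          rw [← Real.mul_rpow (by norm_num) (by norm_num)]
      _ ≤ (3000 : ℝ) ^ α * ((n : ℝ) / N) ^ α := by
          gcongr
          · norm_num

/-- **A-priori upper bound for the polychromatic two-arm probability** (Nolin 2008, Prop. 14
[arXiv 0711.4948: Prop. 13], upper half, `j = 2`, `σ = BW`, `p = 1/2`): there are `C, α > 0`
with `b(n, N) = P_{1/2}(armEvent ![true, false] n N) ≤ C (n/N)^α` for all `1 ≤ n ≤ N`. From
the one-arm bound and the Harris inequality `b ≤ P_{1/2}(one arm)²` (Nolin §4.1, Remark:
`P̂(A_{j+j'}) ≤ P̂(A_j) P̂(A_{j'})`; `polyArmProb_two_le_sq`). [cite: Nolin2008, Prop. 14 (arXiv 0711.4948: Prop. 13)] -/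
theorem exists_critTwoArmProb_le_rpow :
    ∃ C α : ℝ, 0 < C ∧ 0 < α ∧ ∀ n N : ℕ, 1 ≤ n → n ≤ N →
      critTwoArmProb n N ≤ C * ((n : ℝ) / N) ^ α := by
  obtain ⟨C, α, hC, hα, h⟩ := exists_polyArmProb_one_le_rpow
  refine ⟨C ^ 2, 2 * α, by positivity, by positivity, fun n N hn hnN => ?_⟩
  have h1 := h true n N hn hnN
  have h0 : 0 ≤ polyArmProb ![true] n N := measureReal_nonneg
  have hNpos : (0 : ℝ) < N := by
    have : (1 : ℝ) ≤ n := by exact_mod_cast hn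
    have : (n : ℝ) ≤ N := by exact_mod_cast hnN
    linarith
  calc critTwoArmProb n N ≤ polyArmProb ![true] n N ^ 2 := polyArmProb_two_le_sq hnN
    _ ≤ (C * ((n : ℝ) / N) ^ α) ^ 2 := pow_le_pow_left₀ h0 h1 2
    _ = C ^ 2 * ((n : ℝ) / N) ^ (2 * α) := by
        rw [mul_pow, mul_comm (2 : ℝ) α, Real.rpow_mul (by positivity), Real.rpow_two]

end Literature.Probability.Percolation

namespace Literature.Probability.Percolation


/-! ### Gluing: a horizontal and a vertical path meet (box form) -/

/-- **A horizontal and a vertical path meet** (box form used for gluing): if a `𝕋`-path with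
sites in `S` runs from a column `≤ L` to a column `≥ R` and its sites in the columns `[L, R]`
have rows in `[B, T]`, and a `𝕋`-path with sites in `S'` runs from a row `≤ B` to a row `≥ T`
and its sites in the rows `[B, T]` have columns in `[L, R]`, then `S ∩ S'` is nonempty
(slab sub-crossings, `PathIn.exists_slab_crossing`, and `PathIn.tri_crossings_meet`).
(Kesten 1982, §2.2; Grimmett 1999, §11.7.) [cite: KestenPTM1982, §2.2 (paths crossing a rectangle must intersect)] -/
theorem exists_mem_of_cross {S S' : Set (LatticeModels.Site 2)} {p q p' q' : LatticeModels.Site 2} {L R B T : ℤ}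
    (hLR : L ≤ R) (hBT : B ≤ T)
    (hP : PathIn LatticeModels.triGraph S p q) (hp : p 0 ≤ L) (hq : R ≤ q 0)
    (hS : ∀ z ∈ S, L ≤ z 0 → z 0 ≤ R → B ≤ z 1 ∧ z 1 ≤ T)
    (hQ : PathIn LatticeModels.triGraph S' p' q') (hp' : p' 1 ≤ B) (hq' : T ≤ q' 1)
    (hS' : ∀ z ∈ S', B ≤ z 1 → z 1 ≤ T → L ≤ z 0 ∧ z 0 ≤ R) :
    ∃ z, z ∈ S ∧ z ∈ S' := by
  obtain ⟨a, b, ha, hb, hab⟩ := hP.exists_slab_crossing 0 hLR hp hq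
  obtain ⟨c, d, hc, hd, hcd⟩ := hQ.exists_slab_crossing 1 hBT hp' hq'
  obtain ⟨z, hz, hz'⟩ := PathIn.tri_crossings_meet (L := L) (R := R) (B := B) (T := T)
    (A := S ∩ {z : LatticeModels.Site 2 | L ≤ z 0 ∧ z 0 ≤ R}) (A' := S' ∩ {z : LatticeModels.Site 2 | B ≤ z 1 ∧ z 1 ≤ T})
    (fun z hz => ⟨hz.2.1, hz.2.2, (hS z hz.1 hz.2.1 hz.2.2).1, (hS z hz.1 hz.2.1 hz.2.2).2⟩)
    (fun z hz => ⟨(hS' z hz.1 hz.2.1 hz.2.2).1, (hS' z hz.1 hz.2.1 hz.2.2).2, hz.2.1, hz.2.2⟩)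
    hab ha hb hcd hc hd
  exact ⟨z, hz.1, hz'.1⟩

/-! ### The dyadic chain of crossings on the right of the hexagons -/

/-- **Gluing the dyadic chain** (the RSW construction of Nolin 2008, Prop. 14, lower bound, and
Fig. 4; Smirnov–Werner 2001, §4.2 "standard RSW theory"): if the parallelograms
`[2^i n, 2^{i+2} n] × [-2^i n, 0]`, `i ≤ k`, are crossed horizontally and the rhombi
`[2^{i+1} n, 2^{i+2} n] × [-2^{i+1} n, 0]`, `i < k`, vertically by open sites of `ω`, then an
open `𝕋`-path joins the column `x₀ = n` to the column `x₀ = 2^{k+2} n` inside the cone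
`{n ≤ x₀ ≤ 2^{k+2} n, -x₀ ≤ x₁ ≤ 0}` (with the extra book-keeping `x₁ ≥ -2^k n` on the
columns `x₀ ≥ 2^{k+1} n`, used in the induction: consecutive horizontal crossings both cross
the rhombus between them, where they meet its vertical crossing, `exists_mem_of_cross`). [cite: Nolin2008, Prop. 14 (arXiv 0711.4948: Prop. 13)] -/
theorem exists_pathIn_of_dyadicChain {n : ℕ} (hn : 1 ≤ n) {ω : SiteConfig (LatticeModels.Site 2)} :
    ∀ k : ℕ,
      (∀ i : ℕ, i ≤ k → ω ∈ triHCross ((2 ^ i * n : ℕ) : ℤ) (-((2 ^ i * n : ℕ) : ℤ))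
          (3 * (2 ^ i * n)) (2 ^ i * n)) →
      (∀ i : ℕ, i < k → ω ∈ triVCross ((2 ^ (i + 1) * n : ℕ) : ℤ) (-((2 ^ (i + 1) * n : ℕ) : ℤ))
          (2 ^ (i + 1) * n) (2 ^ (i + 1) * n)) →
      ∃ x y : LatticeModels.Site 2, x 0 = n ∧ y 0 = ((2 ^ (k + 2) * n : ℕ) : ℤ) ∧
        PathIn LatticeModels.triGraph ({z : LatticeModels.Site 2 | (n : ℤ) ≤ z 0 ∧ z 0 ≤ ((2 ^ (k + 2) * n : ℕ) : ℤ) ∧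
          z 1 ≤ 0 ∧ -z 0 ≤ z 1 ∧
          (((2 ^ (k + 1) * n : ℕ) : ℤ) ≤ z 0 → -((2 ^ k * n : ℕ) : ℤ) ≤ z 1)} ∩ ω) x y := by
  intro k
  induction k with
  | zero =>
    intro hH _
    obtain ⟨x, y, hx0, hy0, hp⟩ := hH 0 le_rfl
    simp only [pow_zero, one_mul] at hx0 hy0 hp
    refine ⟨x, y, hx0, ?_, hp.mono ?_⟩
    · rw [hy0]; push_cast; ring
    · rintro z ⟨hz, hzω⟩
      rw [mem_triStrip] at hz
      refine ⟨⟨hz.1, ?_, ?_, ?_, ?_⟩, hzω⟩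
      · push_cast at hz ⊢; omega
      · push_cast at hz ⊢; omega
      · push_cast at hz ⊢; omega
      · intro _; push_cast at hz ⊢; omega
  | succ k ih =>
    intro hH hV
    obtain ⟨x, y, hx0, hy0, hXp⟩ :=
      ih (fun i hi => hH i (Nat.le_succ_of_le hi)) (fun i hi => hV i (Nat.lt_succ_of_lt hi))
    obtain ⟨u, v, hu0, hv0, hYp⟩ := hH (k + 1) le_rfl
    obtain ⟨c, d, hc1, hd1, hZp⟩ := hV k (Nat.lt_succ_self k)
    -- express all scales through `P = 2^k n` and `M = 2^{k+1} n = 2P`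
    have eB : (2 ^ (k + 2) * n : ℕ) = 2 * (2 ^ (k + 1) * n) := by ring
    have eB' : (2 ^ (k + 1 + 1) * n : ℕ) = 2 * (2 ^ (k + 1) * n) := by ring
    have eC : (2 ^ (k + 1 + 2) * n : ℕ) = 4 * (2 ^ (k + 1) * n) := by ring
    have hMP : (2 ^ (k + 1) * n : ℕ) = 2 * (2 ^ k * n) := by ring
    have hPn : n ≤ 2 ^ k * n := Nat.le_mul_of_pos_left n (Nat.two_pow_pos k)
    rw [eB'] ; rw [eC]
    rw [eB] at hy0 hXp
    generalize eM : (2 ^ (k + 1) * n : ℕ) = M at hMP hu0 hv0 hYp hc1 hd1 hZp hy0 hXp ⊢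
    generalize eP : (2 ^ k * n : ℕ) = P at hMP hPn hXp ⊢
    subst hMP
    -- tight supports
    obtain ⟨SX, hSX, hXp', hXall⟩ := PathIn.exists_support hXp
    obtain ⟨SY, hSY, hYp', hYall⟩ := PathIn.exists_support hYp
    obtain ⟨SZ, hSZ, hZp', hZall⟩ := PathIn.exists_support hZp
    have bX : ∀ z ∈ SX, (n : ℤ) ≤ z 0 ∧ z 0 ≤ 2 * (2 * (P : ℤ)) ∧ z 1 ≤ 0 ∧ -z 0 ≤ z 1 ∧
        (2 * (P : ℤ) ≤ z 0 → -(P : ℤ) ≤ z 1) ∧ z ∈ ω := by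
      intro z hz
      obtain ⟨hz1, hz2⟩ := hSX hz
      simp only [Set.mem_setOf_eq] at hz1
      push_cast at hz1
      exact ⟨hz1.1, hz1.2.1, hz1.2.2.1, hz1.2.2.2.1, hz1.2.2.2.2, hz2⟩
    have bY : ∀ z ∈ SY, 2 * (P : ℤ) ≤ z 0 ∧ z 0 ≤ 4 * (2 * (P : ℤ)) ∧ -(2 * (P : ℤ)) ≤ z 1 ∧
        z 1 ≤ 0 ∧ z ∈ ω := by
      intro z hz
      obtain ⟨hz1, hz2⟩ := hSY hz
      rw [mem_triStrip] at hz1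
      push_cast at hz1
      refine ⟨hz1.1, by linarith [hz1.2.1], hz1.2.2.1, by linarith [hz1.2.2.2], hz2⟩
    have bZ : ∀ z ∈ SZ, 2 * (P : ℤ) ≤ z 0 ∧ z 0 ≤ 2 * (2 * (P : ℤ)) ∧ -(2 * (P : ℤ)) ≤ z 1 ∧
        z 1 ≤ 0 ∧ z ∈ ω := by
      intro z hz
      obtain ⟨hz1, hz2⟩ := hSZ hz
      rw [mem_triStrip] at hz1
      push_cast at hz1
      refine ⟨hz1.1, by linarith [hz1.2.1], hz1.2.2.1, by linarith [hz1.2.2.2], hz2⟩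
    have hPn' : (n : ℤ) ≤ P := by exact_mod_cast hPn
    have hP0 : (0 : ℤ) ≤ P := by positivity
    push_cast at hu0 hv0 hc1 hd1 hy0 hx0 ⊢
    -- the two meeting sites in the rhombus `Q = [M, 2M] × [-M, 0]`
    obtain ⟨z₁, hz₁X, hz₁Z⟩ := exists_mem_of_cross (L := 2 * (P : ℤ)) (R := 2 * (2 * (P : ℤ)))
      (B := -(2 * (P : ℤ))) (T := 0) (by linarith) (by linarith) hXp' (by rw [hx0]; linarith)
      (by rw [hy0]) (fun z hz h1 _ => ⟨by linarith [(bX z hz).2.2.2.2.1 h1], (bX z hz).2.2.1⟩)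
      hZp' (by rw [hc1]) (by rw [hd1]; linarith)
      (fun z hz _ _ => ⟨(bZ z hz).1, (bZ z hz).2.1⟩)
    obtain ⟨z₂, hz₂Y, hz₂Z⟩ := exists_mem_of_cross (L := 2 * (P : ℤ)) (R := 2 * (2 * (P : ℤ)))
      (B := -(2 * (P : ℤ))) (T := 0) (by linarith) (by linarith) hYp' (by rw [hu0])
      (by rw [hv0]; linarith) (fun z hz _ _ => ⟨(bY z hz).2.2.1, (bY z hz).2.2.2.1⟩)
      hZp' (by rw [hc1]) (by rw [hd1]; linarith)
      (fun z hz _ _ => ⟨(bZ z hz).1, (bZ z hz).2.1⟩)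
    -- the three pieces lie in the target set
    have hmem : ∀ z : LatticeModels.Site 2, (n : ℤ) ≤ z 0 → z 0 ≤ 4 * (2 * (P : ℤ)) → z 1 ≤ 0 → -z 0 ≤ z 1 →
        (2 * (2 * (P : ℤ)) ≤ z 0 → -(2 * (P : ℤ)) ≤ z 1) → z ∈ ω →
        z ∈ {z : LatticeModels.Site 2 | (n : ℤ) ≤ z 0 ∧ z 0 ≤ ((4 * (2 * P) : ℕ) : ℤ) ∧ z 1 ≤ 0 ∧ -z 0 ≤ z 1 ∧
          (((2 * (2 * P) : ℕ) : ℤ) ≤ z 0 → -((2 * P : ℕ) : ℤ) ≤ z 1)} ∩ ω := by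
      intro z h1 h2 h3 h4 h5 h6
      refine ⟨?_, h6⟩
      simp only [Set.mem_setOf_eq]
      push_cast
      exact ⟨h1, h2, h3, h4, h5⟩
    have hSXbig : SX ⊆ {z : LatticeModels.Site 2 | (n : ℤ) ≤ z 0 ∧ z 0 ≤ ((4 * (2 * P) : ℕ) : ℤ) ∧ z 1 ≤ 0 ∧
        -z 0 ≤ z 1 ∧ (((2 * (2 * P) : ℕ) : ℤ) ≤ z 0 → -((2 * P : ℕ) : ℤ) ≤ z 1)} ∩ ω := by
      intro z hz
      obtain ⟨h1, h2, h3, h4, h5, h6⟩ := bX z hz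
      exact hmem z h1 (by linarith) h3 h4 (fun h => by linarith [h5 (by linarith)]) h6
    have hSYbig : SY ⊆ {z : LatticeModels.Site 2 | (n : ℤ) ≤ z 0 ∧ z 0 ≤ ((4 * (2 * P) : ℕ) : ℤ) ∧ z 1 ≤ 0 ∧
        -z 0 ≤ z 1 ∧ (((2 * (2 * P) : ℕ) : ℤ) ≤ z 0 → -((2 * P : ℕ) : ℤ) ≤ z 1)} ∩ ω := by
      intro z hz
      obtain ⟨h1, h2, h3, h4, h5⟩ := bY z hz
      exact hmem z (by linarith) h2 h4 (by linarith) (fun _ => h3) h5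
    have hSZbig : SZ ⊆ {z : LatticeModels.Site 2 | (n : ℤ) ≤ z 0 ∧ z 0 ≤ ((4 * (2 * P) : ℕ) : ℤ) ∧ z 1 ≤ 0 ∧
        -z 0 ≤ z 1 ∧ (((2 * (2 * P) : ℕ) : ℤ) ≤ z 0 → -((2 * P : ℕ) : ℤ) ≤ z 1)} ∩ ω := by
      intro z hz
      obtain ⟨h1, h2, h3, h4, h5⟩ := bZ z hz
      exact hmem z (by linarith) (by linarith) h4 (by linarith) (fun _ => h3) h5
    have p1 : PathIn LatticeModels.triGraph SX x z₁ := hXall z₁ hz₁X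
    have p2 : PathIn LatticeModels.triGraph SZ z₁ z₂ := (hZall z₁ hz₁Z).symm.trans (hZall z₂ hz₂Z)
    have p3 : PathIn LatticeModels.triGraph SY z₂ v := (hYall z₂ hz₂Y).symm.trans hYp'
    refine ⟨x, v, hx0, ?_, ((p1.mono hSXbig).trans (p2.mono hSZbig)).trans (p3.mono hSYbig)⟩
    rw [hv0]; ring

/-- **The dyadic chain is an open arm.** Under the hypotheses of `exists_pathIn_of_dyadicChain`
(`n ≥ 1`), `ω` has an open arm across `Λ_{2^{k+2} n} \ Λ_n`: in the cone `{-x₀ ≤ x₁ ≤ 0}` the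
graph norm is `x₀` (`triNorm_eq_apply_zero`), so the glued path runs in the closed annulus from
`∂Λ_n` to `∂Λ_{2^{k+2} n}`. [cite: Nolin2008, Prop. 14 (arXiv 0711.4948: Prop. 13)] -/
theorem armEvent_one_of_dyadicChain {n : ℕ} (hn : 1 ≤ n) {ω : SiteConfig (LatticeModels.Site 2)} (k : ℕ)
    (hH : ∀ i : ℕ, i ≤ k → ω ∈ triHCross ((2 ^ i * n : ℕ) : ℤ) (-((2 ^ i * n : ℕ) : ℤ))
      (3 * (2 ^ i * n)) (2 ^ i * n))
    (hV : ∀ i : ℕ, i < k → ω ∈ triVCross ((2 ^ (i + 1) * n : ℕ) : ℤ) (-((2 ^ (i + 1) * n : ℕ) : ℤ))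
      (2 ^ (i + 1) * n) (2 ^ (i + 1) * n)) :
    ω ∈ armEvent ![true] n (2 ^ (k + 2) * n) := by
  obtain ⟨x, y, hx0, hy0, hp⟩ := exists_pathIn_of_dyadicChain hn k hH hV
  have hnN : n ≤ 2 ^ (k + 2) * n := Nat.le_mul_of_pos_left n (Nat.two_pow_pos _)
  rw [mem_armEvent_one_iff_exists_pathIn hnN]
  have hxm := hp.left_mem.1
  have hym := hp.right_mem.1
  simp only [Set.mem_setOf_eq] at hxm hym
  refine ⟨x, ?_, y, ?_, hp.mono ?_⟩
  · rw [LatticeModels.mem_triSphere_iff, triNorm_eq_apply_zero hxm.2.2.1 (by linarith [hxm.2.2.2.1]), hx0]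
  · rw [LatticeModels.mem_triSphere_iff, triNorm_eq_apply_zero hym.2.2.1 (by linarith [hym.2.2.2.1]), hy0]
  · rintro z ⟨hz, hzω⟩
    simp only [Set.mem_setOf_eq] at hz
    refine ⟨?_, by simpa using hzω⟩
    simp only [Set.mem_setOf_eq]
    rw [triNorm_eq_apply_zero hz.2.2.1 (by linarith [hz.2.2.2.1])]
    exact ⟨hz.1, hz.2.1⟩

end Literature.Probability.Percolation

namespace Literature.Probability.Percolation


/-! ### The mirror image of a local event and its probability -/

/-- The preimage of an event determined by `S` under "central symmetry composed with colour
exchange", `ω ↦ {x | -x ∈ ω}ᶜ`, is determined by `-S`. [folklore] -/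
theorem determinedBy_preimage_relabel_neg_compl {E : Set (SiteConfig (LatticeModels.Site 2))} {S : Set (LatticeModels.Site 2)}
    (hE : DeterminedBy E S) :
    DeterminedBy
      ((fun ω : SiteConfig (LatticeModels.Site 2) => (SiteConfig.relabel (Equiv.neg (LatticeModels.Site 2)) ω)ᶜ) ⁻¹' E)
      (Neg.neg ⁻¹' S) := by
  rw [determinedBy_iff] at hE ⊢
  intro ω ω' h
  simp only [Set.mem_preimage]
  refine hE _ _ (Set.ext fun x => ?_)
  have := Set.ext_iff.1 h (-x)
  simp only [Set.mem_inter_iff, Set.mem_preimage, neg_neg, Set.mem_compl_iff,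
    SiteConfig.mem_relabel_iff, Equiv.neg_symm, Equiv.neg_apply] at this ⊢
  tauto

/-- "Central symmetry composed with colour exchange" preserves `P_{1/2}` (lattice symmetry,
`sitePercolation_real_preimage_relabel`, and self-duality of `p = 1/2`,
`sitePercolation_real_preimage_compl`; Smirnov–Werner 2001, Rem. 2). [cite: SmirnovWernerMRL2001, Rem. 2] -/
theorem triSitePercolation_real_preimage_relabel_neg_compl (E : Set (SiteConfig (LatticeModels.Site 2))) :
    (LatticeModels.triSitePercolation half).real
        ((fun ω : SiteConfig (LatticeModels.Site 2) => (SiteConfig.relabel (Equiv.neg (LatticeModels.Site 2)) ω)ᶜ) ⁻¹' E) =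
      (LatticeModels.triSitePercolation half).real E := by
  have hs : unitInterval.symm half = half := Subtype.ext (by simp [half]; norm_num)
  have : ((fun ω : SiteConfig (LatticeModels.Site 2) => (SiteConfig.relabel (Equiv.neg (LatticeModels.Site 2)) ω)ᶜ) ⁻¹' E) =
      SiteConfig.relabel (Equiv.neg (LatticeModels.Site 2)) ⁻¹' (compl ⁻¹' E) := rfl
  rw [this, LatticeModels.triSitePercolation, sitePercolation_real_preimage_relabel,
    sitePercolation_real_preimage_compl, hs]

/-! ### Probability of the dyadic chain and of the two arms it produces -/

/-- **RSW lower bound along dyadic scales** (the proof of the lower half of Nolin 2008, Prop. 14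
[arXiv 0711.4948: Prop. 13], for `j = 1` and for `j = 2`, `σ = BW`, at `p = 1/2`). There is
`c₀ ∈ (0, 1/2]` (the RSW box-crossing constant of `tri_rsw_half_holds` at aspect ratio `3`)
such that for all `n ≥ 1` and `k`:
`P_{1/2}(open arm across Λ_{2^{k+2} n} \ Λ_n) ≥ c₀^{2k+1}` — the dyadic chain of `k + 1` open
horizontal and `k` open vertical box crossings on the right of the hexagons
(`armEvent_one_of_dyadicChain`), by the Harris chain `sitePercolation_real_biInter_ge_prod` and
Harris's inequality — and `b(n, 2^{k+2} n) ≥ c₀^{4k+2}`: the mirror image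
`ω ↦ {x | -x ∈ ω}ᶜ` of the chain event is a closed arm on the left
(`mem_armEvent_one_of_relabel_neg_compl`), has the same probability
(`triSitePercolation_real_preimage_relabel_neg_compl`) and is independent of it (the chain lives
on `{x₀ ≥ n}`, its mirror image on `{x₀ ≤ -n}`: `sitePercolation_real_inter_of_disjoint`),
and `armEvent ![true, false] = armEvent ![true] ∩ armEvent ![false]` (`armEvent_two_eq_inter`). [cite: Nolin2008, Prop. 14 (arXiv 0711.4948: Prop. 13)] -/
theorem exists_pow_le_polyArmProb_dyadic :
    ∃ c₀ : ℝ, 0 < c₀ ∧ c₀ ≤ 1 / 2 ∧ ∀ n k : ℕ, 1 ≤ n →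
      c₀ ^ (2 * k + 1) ≤ polyArmProb ![true] n (2 ^ (k + 2) * n) ∧
        c₀ ^ (4 * k + 2) ≤ critTwoArmProb n (2 ^ (k + 2) * n) := by
  classical
  obtain ⟨c₀, hc₀, hrsw⟩ := tri_rsw_half_holds (3 : ℝ) (by norm_num)
  have key : ∀ w h : ℕ, 1 ≤ h → w ≤ 3 * h → c₀ ≤ triLRCrossingProb half w h := by
    intro w h hh hw
    have hfl : ⌊(3 : ℝ) * h⌋₊ = 3 * h := by
      have : (3 : ℝ) * h = ((3 * h : ℕ) : ℝ) := by push_cast; ring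
      rw [this, Nat.floor_natCast]
    obtain ⟨h1, -⟩ := hrsw h (by rw [hfl]; omega)
    rw [hfl] at h1
    exact h1.trans (triLRCrossingProb_anti_width half hw h)
  have hc₀le : c₀ ≤ 1 / 2 := by
    have hfl : ⌊(3 : ℝ) * ((1 : ℕ) : ℝ)⌋₊ = 3 := by norm_num
    obtain ⟨h1, h2⟩ := hrsw 1 (by rw [hfl]; norm_num)
    linarith
  refine ⟨c₀, hc₀, hc₀le, fun n k hn => ?_⟩
  have hnN : n ≤ 2 ^ (k + 2) * n := Nat.le_mul_of_pos_left n (Nat.two_pow_pos _)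
  -- the events of the chain and their supports
  set H : ℕ → Set (SiteConfig (LatticeModels.Site 2)) := fun i =>
    triHCross ((2 ^ i * n : ℕ) : ℤ) (-((2 ^ i * n : ℕ) : ℤ)) (3 * (2 ^ i * n)) (2 ^ i * n) with hH
  set FH : ℕ → Finset (LatticeModels.Site 2) := fun i =>
    triStripFinset ((2 ^ i * n : ℕ) : ℤ) (-((2 ^ i * n : ℕ) : ℤ)) (3 * (2 ^ i * n)) (2 ^ i * n)
    with hFH
  set V : ℕ → Set (SiteConfig (LatticeModels.Site 2)) := fun i =>
    triVCross ((2 ^ (i + 1) * n : ℕ) : ℤ) (-((2 ^ (i + 1) * n : ℕ) : ℤ)) (2 ^ (i + 1) * n)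
      (2 ^ (i + 1) * n) with hV
  set FV : ℕ → Finset (LatticeModels.Site 2) := fun i =>
    triStripFinset ((2 ^ (i + 1) * n : ℕ) : ℤ) (-((2 ^ (i + 1) * n : ℕ) : ℤ)) (2 ^ (i + 1) * n)
      (2 ^ (i + 1) * n) with hFV
  set IH : Set (SiteConfig (LatticeModels.Site 2)) := ⋂ i ∈ Finset.range (k + 1), H i with hIH
  set IV : Set (SiteConfig (LatticeModels.Site 2)) := ⋂ i ∈ Finset.range k, V i with hIV
  set F : Finset (LatticeModels.Site 2) := (Finset.range (k + 1)).biUnion FH ∪ (Finset.range k).biUnion FV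
    with hF
  -- locality and monotonicity
  have dH : DeterminedBy IH ↑((Finset.range (k + 1)).biUnion FH) :=
    DeterminedBy.biInter_finset _ fun i _ => determinedBy_triHCross _ _ _ _
  have dV : DeterminedBy IV ↑((Finset.range k).biUnion FV) :=
    DeterminedBy.biInter_finset _ fun i _ => determinedBy_triVCross _ _ _ _
  have dR : DeterminedBy (IH ∩ IV) ↑F := by
    rw [hF, Finset.coe_union]
    exact (dH.mono Set.subset_union_left).inter (dV.mono Set.subset_union_right)
  have uH : IsUpperSet IH := isUpperSet_iInter₂ fun i _ => isUpperSet_triHCross _ _ _ _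
  have uV : IsUpperSet IV := isUpperSet_iInter₂ fun i _ => isUpperSet_triVCross _ _ _ _
  -- RSW and the Harris chain
  have pH : c₀ ^ (k + 1) ≤ (LatticeModels.triSitePercolation half).real IH := by
    have h := sitePercolation_real_biInter_ge_prod half (Finset.range (k + 1)) (E := H) (F := FH)
      (fun i _ => determinedBy_triHCross _ _ _ _) (fun i _ => isUpperSet_triHCross _ _ _ _)
    refine le_trans ?_ h
    calc c₀ ^ (k + 1) = ∏ _i ∈ Finset.range (k + 1), c₀ := by simp
      _ ≤ ∏ i ∈ Finset.range (k + 1), (sitePercolation (LatticeModels.Site 2) half).real (H i) := by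
          refine Finset.prod_le_prod (fun _ _ => hc₀.le) fun i _ => ?_
          have : (sitePercolation (LatticeModels.Site 2) half).real (H i) =
              triLRCrossingProb half (3 * (2 ^ i * n)) (2 ^ i * n) :=
            triSitePercolation_real_triHCross half _ _ _ _
          rw [this]
          exact key _ _ (Nat.mul_pos (Nat.two_pow_pos i) hn) le_rfl
  have pV : c₀ ^ k ≤ (LatticeModels.triSitePercolation half).real IV := by
    have h := sitePercolation_real_biInter_ge_prod half (Finset.range k) (E := V) (F := FV)
      (fun i _ => determinedBy_triVCross _ _ _ _) (fun i _ => isUpperSet_triVCross _ _ _ _)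
    refine le_trans ?_ h
    calc c₀ ^ k = ∏ _i ∈ Finset.range k, c₀ := by simp
      _ ≤ ∏ i ∈ Finset.range k, (sitePercolation (LatticeModels.Site 2) half).real (V i) := by
          refine Finset.prod_le_prod (fun _ _ => hc₀.le) fun i _ => ?_
          have : (sitePercolation (LatticeModels.Site 2) half).real (V i) =
              triLRCrossingProb half (2 ^ (i + 1) * n) (2 ^ (i + 1) * n) :=
            triSitePercolation_real_triVCross half _ _ _ _
          rw [this]
          exact key _ _ (Nat.mul_pos (Nat.two_pow_pos _) hn) (Nat.le_mul_of_pos_left _ (by norm_num))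
  have pR : c₀ ^ (2 * k + 1) ≤ (LatticeModels.triSitePercolation half).real (IH ∩ IV) := by
    have h := sitePercolation_harris' half dH dV uH uV
    calc c₀ ^ (2 * k + 1) = c₀ ^ (k + 1) * c₀ ^ k := by rw [← pow_add]; ring_nf
      _ ≤ (LatticeModels.triSitePercolation half).real IH * (LatticeModels.triSitePercolation half).real IV :=
          mul_le_mul pH pV (by positivity) measureReal_nonneg
      _ ≤ (LatticeModels.triSitePercolation half).real (IH ∩ IV) := h
  -- the chain is an open arm on the right
  have hRarm : IH ∩ IV ⊆ armEvent ![true] n (2 ^ (k + 2) * n) := by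
    rintro ω ⟨h1, h2⟩
    rw [hIH] at h1
    rw [hIV] at h2
    simp only [Set.mem_iInter, Finset.mem_range] at h1 h2
    exact armEvent_one_of_dyadicChain hn k (fun i hi => h1 i (Nat.lt_succ_of_le hi))
      (fun i hi => h2 i hi)
  -- its mirror image is a closed arm on the left, independent of it and of the same probability
  set L : Set (SiteConfig (LatticeModels.Site 2)) :=
    (fun ω : SiteConfig (LatticeModels.Site 2) => (SiteConfig.relabel (Equiv.neg (LatticeModels.Site 2)) ω)ᶜ) ⁻¹' (IH ∩ IV)
    with hL
  have hLarm : L ⊆ armEvent ![false] n (2 ^ (k + 2) * n) := fun ω hω =>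
    mem_armEvent_one_of_relabel_neg_compl (c := true) hnN (hRarm hω)
  have dL : DeterminedBy L ↑(F.image Neg.neg) := by
    rw [coe_image_neg]; exact determinedBy_preimage_relabel_neg_compl dR
  have hvF : ∀ w ∈ F, (n : ℤ) ≤ w 0 := by
    intro w hw
    rw [hF, Finset.mem_union, Finset.mem_biUnion, Finset.mem_biUnion] at hw
    rcases hw with ⟨i, -, hw⟩ | ⟨i, -, hw⟩
    · have hw' : w ∈ (↑(FH i) : Set (LatticeModels.Site 2)) := hw
      simp only [hFH, coe_triStripFinset, mem_triStrip] at hw'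
      have : n ≤ 2 ^ i * n := Nat.le_mul_of_pos_left n (Nat.two_pow_pos i)
      have : (n : ℤ) ≤ ((2 ^ i * n : ℕ) : ℤ) := by exact_mod_cast this
      exact this.trans hw'.1
    · have hw' : w ∈ (↑(FV i) : Set (LatticeModels.Site 2)) := hw
      simp only [hFV, coe_triStripFinset, mem_triStrip] at hw'
      have : n ≤ 2 ^ (i + 1) * n := Nat.le_mul_of_pos_left n (Nat.two_pow_pos _)
      have : (n : ℤ) ≤ ((2 ^ (i + 1) * n : ℕ) : ℤ) := by exact_mod_cast this
      exact this.trans hw'.1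
  have hdisj : Disjoint F (F.image Neg.neg) := by
    rw [Finset.disjoint_left]
    intro v hv hv'
    have h1 := hvF v hv
    rw [Finset.mem_image] at hv'
    obtain ⟨w, hw, rfl⟩ := hv'
    have h2 := hvF w hw
    simp only [Pi.neg_apply] at h1
    have : (1 : ℤ) ≤ n := by exact_mod_cast hn
    omega
  have hPL : (LatticeModels.triSitePercolation half).real L = (LatticeModels.triSitePercolation half).real (IH ∩ IV) :=
    triSitePercolation_real_preimage_relabel_neg_compl _
  have hind : (LatticeModels.triSitePercolation half).real ((IH ∩ IV) ∩ L) =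
      (LatticeModels.triSitePercolation half).real (IH ∩ IV) * (LatticeModels.triSitePercolation half).real L :=
    sitePercolation_real_inter_of_disjoint half dR dL hdisj
  have hsub : (IH ∩ IV) ∩ L ⊆ armEvent ![true, false] n (2 ^ (k + 2) * n) := by
    rw [armEvent_two_eq_inter]; exact Set.inter_subset_inter hRarm hLarm
  refine ⟨pR.trans (measureReal_mono hRarm (measure_ne_top _ _)), ?_⟩
  calc c₀ ^ (4 * k + 2) = c₀ ^ (2 * k + 1) * c₀ ^ (2 * k + 1) := by rw [← pow_add]; ring_nf
    _ ≤ (LatticeModels.triSitePercolation half).real (IH ∩ IV) * (LatticeModels.triSitePercolation half).real L := by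
        rw [hPL]
        exact mul_le_mul pR pR (by positivity) (le_trans (by positivity) pR)
    _ = (LatticeModels.triSitePercolation half).real ((IH ∩ IV) ∩ L) := hind.symm
    _ ≤ critTwoArmProb n (2 ^ (k + 2) * n) := measureReal_mono hsub (measure_ne_top _ _)

/-! ### From dyadic scales to power laws -/

/-- **Geometric in the number of scales is polynomial in the ratio**: if `2^k ≤ N/n` and
`0 < c₀ < 1` then `(n/N)^{log₂(1/c₀)} ≤ c₀^k`. [folklore] -/
theorem rpow_ratio_le_pow {c₀ : ℝ} (h0 : 0 < c₀) (h1 : c₀ < 1) {n N k : ℕ} (hn : 1 ≤ n)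
    (hnN : n ≤ N) (hk : (2 : ℝ) ^ k ≤ (N : ℝ) / n) :
    ((n : ℝ) / N) ^ (-Real.log c₀ / Real.log 2) ≤ c₀ ^ k := by
  have hn' : (0 : ℝ) < n := by exact_mod_cast hn
  have hN' : (0 : ℝ) < N := by exact_mod_cast (lt_of_lt_of_le hn hnN)
  have hlog2 : 0 < Real.log 2 := Real.log_pos one_lt_two
  have hlogc : Real.log c₀ < 0 := Real.log_neg h0 h1
  have hx : 0 < (n : ℝ) / N := div_pos hn' hN'
  apply le_pow_of_log_le_mul_log h0 (Real.rpow_pos_of_pos hx _)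
  rw [Real.log_rpow hx]
  have hkl : (k : ℝ) * Real.log 2 ≤ Real.log ((N : ℝ) / n) := by
    have := Real.log_le_log (by positivity) hk
    rwa [Real.log_pow] at this
  have hnN' : Real.log ((n : ℝ) / N) = -Real.log ((N : ℝ) / n) := by
    rw [Real.log_div hn'.ne' hN'.ne', Real.log_div hN'.ne' hn'.ne']; ring
  rw [hnN']
  have ha : Real.log c₀ / Real.log 2 ≤ 0 := (div_neg_of_neg_of_pos hlogc hlog2).le
  have hl2 : Real.log 2 ≠ 0 := hlog2.ne'
  calc -Real.log c₀ / Real.log 2 * -Real.log ((N : ℝ) / n)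
        = Real.log c₀ / Real.log 2 * Real.log ((N : ℝ) / n) := by ring
    _ ≤ Real.log c₀ / Real.log 2 * ((k : ℝ) * Real.log 2) := mul_le_mul_of_nonpos_left hkl ha
    _ = (k : ℝ) * Real.log c₀ := by field_simp

/-- The dyadic index of a ratio: for `1 ≤ n ≤ N` and `k = ⌊log₂ ⌊N/n⌋⌋`, `2^k ≤ N/n` and
`N ≤ 2^{k+2} n`. [folklore] -/
theorem dyadicIndex_spec {n N : ℕ} (hn : 1 ≤ n) (hnN : n ≤ N) :
    (2 : ℝ) ^ Nat.log 2 (N / n) ≤ (N : ℝ) / n ∧ N ≤ 2 ^ (Nat.log 2 (N / n) + 2) * n := by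
  set k : ℕ := Nat.log 2 (N / n) with hk
  have hNn : 1 ≤ N / n := (Nat.one_le_div_iff (by omega)).2 hnN
  have hk1 : 2 ^ k ≤ N / n := Nat.pow_log_le_self 2 (by omega)
  have hk2 : N / n < 2 ^ (k + 1) := Nat.lt_pow_succ_log_self one_lt_two _
  have hN1 : N < 2 ^ (k + 1) * n := (Nat.div_lt_iff_lt_mul (by omega)).1 hk2
  constructor
  · have h1 : ((2 ^ k : ℕ) : ℝ) ≤ ((N / n : ℕ) : ℝ) := by exact_mod_cast hk1
    push_cast at h1
    exact h1.trans Nat.cast_div_le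
  · have : 2 ^ (k + 1) * n ≤ 2 ^ (k + 2) * n :=
      Nat.mul_le_mul_right n (Nat.pow_le_pow_right (by norm_num) (by omega))
    omega

end Literature.Probability.Percolation

namespace Literature.Probability.Percolation

open LatticeModels

/-- **A-priori lower bound for the polychromatic two-arm probability** (Nolin 2008, Prop. 14
[arXiv 0711.4948: Prop. 13], lower half, `j = 2`, `σ = BW`, `p = 1/2`: "`C_j (n/N)^{α_j} ≤
P̂(Ã_{j,σ}(n, N))`", "the lower bound comes from iterating" RSW extensions; Smirnov–Werner 2001,
§4.2: "by standard RSW theory, `b_j(r, R)` is bounded from below by a power of `R/r`"). There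
are `c, ζ > 0` with `c (n/N)^ζ ≤ b(n, N) = P_{1/2}(armEvent ![true, false] n N)` for all
`1 ≤ n ≤ N` (dyadic chain `exists_pow_le_polyArmProb_dyadic` with `k = ⌊log₂ (N/n)⌋`,
anti-monotonicity `polyArmProb_anti_holds` of `b(n, ·)`, and `ζ = 4 log₂ (1/c₀)`). [cite: Nolin2008, Prop. 14 (arXiv 0711.4948: Prop. 13)] [cite: SmirnovWernerMRL2001, §4.2] -/
theorem exists_rpow_le_critTwoArmProb :
    ∃ c ζ : ℝ, 0 < c ∧ 0 < ζ ∧ ∀ n N : ℕ, 1 ≤ n → n ≤ N →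
      c * ((n : ℝ) / N) ^ ζ ≤ critTwoArmProb n N := by
  obtain ⟨c₀, hc₀, hc₀le, h⟩ := exists_pow_le_polyArmProb_dyadic
  have hc₀1 : c₀ < 1 := by linarith
  set ζ₁ : ℝ := -Real.log c₀ / Real.log 2 with hζ₁
  have hζ₁pos : 0 < ζ₁ :=
    div_pos (neg_pos.2 (Real.log_neg hc₀ hc₀1)) (Real.log_pos one_lt_two)
  refine ⟨c₀ ^ 2, 4 * ζ₁, by positivity, by positivity, fun n N hn hnN => ?_⟩
  obtain ⟨hreal, hN2⟩ := dyadicIndex_spec hn hnN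
  set k : ℕ := Nat.log 2 (N / n) with hk
  have hmono : critTwoArmProb n (2 ^ (k + 2) * n) ≤ critTwoArmProb n N :=
    polyArmProb_anti_holds _ hnN hN2
  have hpow := rpow_ratio_le_pow hc₀ hc₀1 hn hnN hreal
  have hx0 : 0 ≤ (n : ℝ) / N := by positivity
  have hx : 0 ≤ ((n : ℝ) / N) ^ ζ₁ := Real.rpow_nonneg hx0 _
  calc c₀ ^ 2 * ((n : ℝ) / N) ^ (4 * ζ₁) = c₀ ^ 2 * (((n : ℝ) / N) ^ ζ₁) ^ 4 := by
        rw [mul_comm (4 : ℝ) ζ₁, Real.rpow_mul hx0]; norm_cast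
    _ ≤ c₀ ^ 2 * (c₀ ^ k) ^ 4 := by gcongr
    _ = c₀ ^ (4 * k + 2) := by rw [← pow_mul, ← pow_add]; ring_nf
    _ ≤ critTwoArmProb n (2 ^ (k + 2) * n) := (h n k hn).2
    _ ≤ critTwoArmProb n N := hmono

/-- **A-priori lower bound for one arm** (Nolin 2008, Prop. 14 [arXiv 0711.4948: Prop. 13],
lower half, `j = 1`, `p = 1/2`): there are `c, ζ > 0` with
`c (n/N)^ζ ≤ P_{1/2}(armEvent ![col] n N)` for all `1 ≤ n ≤ N` and both colours (colour
exchange, `polyArmProb_one_false`). [cite: Nolin2008, Prop. 14 (arXiv 0711.4948: Prop. 13)] -/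
theorem exists_rpow_le_polyArmProb_one :
    ∃ c ζ : ℝ, 0 < c ∧ 0 < ζ ∧ ∀ (col : Bool) (n N : ℕ), 1 ≤ n → n ≤ N →
      c * ((n : ℝ) / N) ^ ζ ≤ polyArmProb ![col] n N := by
  obtain ⟨c₀, hc₀, hc₀le, h⟩ := exists_pow_le_polyArmProb_dyadic
  have hc₀1 : c₀ < 1 := by linarith
  set ζ₁ : ℝ := -Real.log c₀ / Real.log 2 with hζ₁
  have hζ₁pos : 0 < ζ₁ :=
    div_pos (neg_pos.2 (Real.log_neg hc₀ hc₀1)) (Real.log_pos one_lt_two)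
  refine ⟨c₀, 2 * ζ₁, hc₀, by positivity, fun col n N hn hnN => ?_⟩
  obtain ⟨hreal, hN2⟩ := dyadicIndex_spec hn hnN
  set k : ℕ := Nat.log 2 (N / n) with hk
  have hcol : polyArmProb ![col] n N = polyArmProb ![true] n N := by
    cases col
    · exact polyArmProb_one_false n N
    · rfl
  have hmono : polyArmProb ![true] n (2 ^ (k + 2) * n) ≤ polyArmProb ![true] n N :=
    polyArmProb_anti_holds _ hnN hN2
  have hpow := rpow_ratio_le_pow hc₀ hc₀1 hn hnN hreal
  have hx0 : 0 ≤ (n : ℝ) / N := by positivity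
  have hx : 0 ≤ ((n : ℝ) / N) ^ ζ₁ := Real.rpow_nonneg hx0 _
  rw [hcol]
  calc c₀ * ((n : ℝ) / N) ^ (2 * ζ₁) = c₀ * (((n : ℝ) / N) ^ ζ₁) ^ 2 := by
        rw [mul_comm (2 : ℝ) ζ₁, Real.rpow_mul hx0]; norm_cast
    _ ≤ c₀ * (c₀ ^ k) ^ 2 := by gcongr
    _ = c₀ ^ (2 * k + 1) := by rw [← pow_mul, ← pow_succ']; ring_nf
    _ ≤ polyArmProb ![true] n (2 ^ (k + 2) * n) := (h n k hn).1
    _ ≤ polyArmProb ![true] n N := hmono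

end Literature.Probability.Percolation

end
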